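import Literature.AlgebraicGeometry.Motives.HodgeStructureStrongCMHodgeLieRankBound
import Literature.AlgebraicGeometry.Motives.HodgeStructurePolarizationAdjointPoints
import HarnessLib

/-!
# Milne's `S(A) ≅ S₀(A)_{/K}` and `L(A) ≅ L₀(A)_{/K}` for a strong CM-Hodge structure, on `K`-points: the Lefschetz group
# `S(H)(K)` is `η_K` of the unitary group `U_{F₀}(K) = {u ∈ (F₀ ⊗ K)^× : u^τ u = 1}` of the central subfield with its Rosati
# involution, `Hg(V)(K) ⊂ η_K(U_{F₀}(K))`, and `M_φ̃(K) ⊂ η_K{u : u^τ u = ν ∈ K^×}` with `ν` the multiplier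
# (Milne, *Lefschetz classes on abelian varieties*, §1 p. 645 and Prop. 1.7; *Lefschetz motives*, Remark 1.10; GGK §V.D p. 164)

[topic AlgebraicGeometry/Motives]

Layer `Literature/AlgebraicGeometry/Motives`, lane `lit-hodgefound` (Track 2 foundations library; seat `lit-hodgefound-p02`, gen 37,
row g37-#6). THEOREMS ONLY: no definition, no named fact (D-0026 net debt `0`), no instance, no notation. The `K`-POINTS form of
g37-#5 §4 (`exists_centralSubfield_ι_eq_and_rosati_mul_self_eq_one_of_mem_hodgeGroup`: `Hg(V)(ℚ) ⊂ η(U_{F₀}(ℚ))`, listed there as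
not done on `K`-points), BY NAME on: the seat's g37-#1 `Motives/HodgeStructureCMActionScalarExtensionOver` (`η_K = scalarExtensionOver K`,
`unitsActionOver K`, `mem_range_unitsActionOver_centralSubfield_iff`: `Z_{GL(V ⊗ K)}(E_φ ⊗ K) = η_K((F₀ ⊗ K)^×)`,
`mumfordTateGroupBaseChange_le_range_unitsActionOver_centralSubfield`, `hodgeTorusCentralUnits`), g37-#5
`Motives/HodgeStructureStrongCMHodgeLieRankBound` (the Rosati involution `τ` of `F₀`: `exists_rosati_centralSubfield`,
`η(x)† = η(τ x)`), and p34's `Motives/HodgeStructurePolarizationAdjointPoints` (Milne's `K`-linear adjoint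
`Polarization.adjointBaseChange K`, `adjointBaseChange_baseChange`, `mem_lefschetzGroupBaseChange_iff_adjointBaseChange_mul_self_eq_one`,
`mem_lefschetzSimilitudeGroupBaseChange_iff_adjointBaseChange_mul_self_eq_smul`, `adjointBaseChange_mul_self_eq_multiplierChar_smul`)
and `Motives/HodgeStructureLefschetzGroupPoints` (`S(H)(K) = Polarization.lefschetzGroupBaseChange K`,
`G(H)(K) = lefschetzSimilitudeGroupBaseChange K`, `hodgeGroupBaseChange_le_lefschetzGroupBaseChange`).

## The sources, verbatim

* J. S. Milne, *Lefschetz classes on abelian varieties*, Duke Math. J. **96** (1999) [Milne1999LefschetzClasses] (held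
  `paper:doi-10-1215-s0012-7094-99-09620-5`, p0007 = p. 645, read this session): «Every Rosati involution `†` preserves each factor
  of `C₀(A)` and acts on it as complex conjugation. Define `S₀(A)` to be the algebraic group over `ℚ` such that, for all commutative
  `ℚ`-algebras `R`, `S₀(A)(R) = {γ ∈ C₀(A) ⊗_ℚ R | γ†γ = 1}`. **Proposition 1.7.** The action of `End⁰(A)` on `V(A)` induces an
  isomorphism `C₀(A) ⊗_ℚ Q → C(A)` of `Q`-algebras with involution, and hence an isomorphism of algebraic groups `S₀(A)_{/Q} → S(A)`.»
  (printed for abelian varieties over `𝔽`; the characteristic-zero twin is the next item); p0022 = p. 660: «`L(A) ⊃ Hg(A)`».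
* J. S. Milne, *Lefschetz motives and the Tate conjecture*, Compositio Math. **117** (1999) [Milne1999] (held
  `paper:doi-10-1023-a-1000776613765`, p0009 = p. 53, quoted in p34's `HodgeStructureLefschetzGroupCM`): «Let `A` be a simple Abelian
  variety with many endomorphisms, and let `C₀(A)` be the centre of `End⁰(A)`. A Rosati involution on `End⁰(A)` defines an involution
  on `C₀(A)`, which is independent of the choice of the Rosati involution. For any Weil cohomology theory `H` with coefficient field
  `Q`, the canonical map `C₀(A) ⊗_ℚ Q → C(A)` is an isomorphism […]. Therefore, `L(A) ≅ L₀(A)_{/Q}` where `L₀(A)` is the algebraic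
  group over `ℚ` such that `L₀(A)(R) = {(γ, c) ∈ C₀(A)^× × R^× | γ†γ = c}` for all `ℚ`-algebras `R`.»
* M. Green, P. Griffiths, M. Kerr, *Mumford–Tate Groups and Domains* [GreenGriffithsKerr2012], §V.D p. 164: «On the level of
  algebraic groups, the last inclusion becomes `Res_{K₁/ℚ}𝔾_m × ⋯ ⊃ M_φ̃`» (a SCMHS: `ℓ = 1`, `K₁ ≅ F₀`).

## The reading (`A : EndAction H E` strong, `hS : [F:ℚ] = dim V`; `F₀ = A.centralSubfield`; `ψ : Polarization H`; `K ⊇ ℚ` a field)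

`C(H) ⊗ K = η_K(F₀ ⊗ K)` and `Z_{GL(V⊗K)}(E_φ ⊗ K) = η_K((F₀ ⊗ K)^×)` are g37-#1 (`η_K` = `scalarExtensionOver K` of the restricted
action `A.compHom F₀.val`, on units `unitsActionOver K`). The Rosati involution of `ψ` restricted to `F₀` is a `ℚ`-linear `τ`
with `η(x)† = η(τ x)` (g37-#5; any such `τ` — it is unique, an involutive field automorphism, complex conjugation under every
embedding); its `K`-linear extension is Mathlib's `LinearMap.baseChange K τ` on `K ⊗_ℚ F₀`. «`C₀ ⊗ Q → C` is an isomorphism of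
algebras WITH INVOLUTION» becomes `η_K(u)† = η_K(τ_K u)` for Milne's `K`-linear adjoint `†` (§1); «`S₀(A)_{/Q} ≅ S(A)`» becomes
`S(H)(K) = η_K{u ∈ (F₀ ⊗ K)^× : τ_K(u) u = 1}` (§2); «`L(A) ≅ L₀(A)_{/Q}`» becomes `G(H)(K) = η_K{u : τ_K(u) u = c, c ∈ K^×}` (§3),
and on `M_φ̃(K) ⊂ G(H)(K)` the scalar `c` is the multiplier `ν(γ)` (p34's `multiplierChar`).

## What is proved

* §1 **`adjointBaseChange_scalarExtensionOver_centralSubfield`** — `η_K(u)† = η_K(τ_K u)` for all `u ∈ F₀ ⊗ K` («isomorphism of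
  algebras with involution»); `rosati_baseChange_mul`, `rosati_baseChange_one`, `rosati_baseChange_apply_apply` (`τ_K` is an involutive
  `K`-algebra automorphism of `F₀ ⊗ K`, through the injectivity of `η_K`).
* §2 **`mem_lefschetzGroupBaseChange_iff_exists_units_centralSubfield`** — «`S(A) ≅ S₀(A)_{/K}`»: `γ ∈ S(H)(K)` iff `γ = η_K(u)` for a
  unit `u` of `F₀ ⊗ K` with `τ_K(u) · u = 1`; **`exists_units_centralSubfield_of_mem_hodgeGroupBaseChange`** — «`L(A) ⊃ Hg(A)`» in
  these coordinates: `Hg(V)(K) ⊂ η_K(U_{F₀}(K))` for EVERY field `K ⊇ ℚ` (g37-#5 §4 is `K = ℚ`).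
* §3 **`mem_lefschetzSimilitudeGroupBaseChange_iff_exists_units_centralSubfield`** — «`L(A) ≅ L₀(A)_{/K}`»: `γ ∈ G(H)(K)` iff
  `γ = η_K(u)` with `τ_K(u) · u = c · 1` (`= c ⊗ 1`), `c ∈ K^×`; **`exists_units_centralSubfield_of_mem_mumfordTateGroupBaseChange`** — for
  `γ ∈ M_φ̃(K)`: `γ = η_K(u)` with `τ_K(u) · u = ν(γ) · 1`, `ν` the multiplier character; `rosati_baseChange_mumfordTateCentralUnitsHom_mul_self`
  (the same for g37-#1's `mumfordTateCentralUnitsHom : M_φ̃(K) →* (F₀ ⊗ K)^×`).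
* §4 THE DELIGNE TORUS: **`rosati_baseChange_hodgeTorusCentralUnits_mul_self`** — for g37-#1's `u(z,w) ∈ (F₀ ⊗ ℂ)^×` with
  `η_ℂ(u(z,w)) = h_ℂ(z,w)`: `τ_ℂ(u(z,w)) · u(z,w) = (zw)ⁿ · 1` (Deligne's «`ψ(g₁v, g₁v′) = g₂ⁿ ψ(v, v′)`», the tree's
  `coe_multiplierChar_hodgeTorusC`); `rosati_baseChange_hodgeTorusCentralUnits_one_mul_self` (`μ(z) = h_ℂ(z,1)`: `τ_ℂ(u) u = zⁿ · 1`).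

HONEST SCOPE: points only (no group schemes `S₀`, `L₀`, `U_{F₀}`; the sets `{u : τ_K(u) u = 1}` are not packaged as `Subgroup`s —
a definition row if wanted); the converse inclusions `η_K(U_{F₀}(K)) ⊂ Hg(V)(K)` hold only in the nondegenerate case and are not
claimed; `τ` enters as a hypothesis `hτ` (existence: g37-#5 `exists_rosati_centralSubfield`). Universe-polymorphic.

## References

* [Milne1999LefschetzClasses] J. S. Milne, *Lefschetz classes on abelian varieties*, Duke Math. J. 96 (1999) 639–675: §1 p. 645
  (`S₀(A)`, Prop. 1.7 «`S₀(A)_{/Q} → S(A)` … of algebras with involution»), §4 p. 660 («`L(A) ⊃ Hg(A)`»), Thm. 4.4 (the multiplier).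
* [Milne1999] J. S. Milne, *Lefschetz motives and the Tate conjecture*, Compositio Math. 117 (1999) 47–81: Remark 1.10 p. 53
  («`L(A) ≅ L₀(A)_{/Q}`, `L₀(A)(R) = {(γ, c) ∈ C₀(A)^× × R^× | γ†γ = c}`»).
* [GreenGriffithsKerr2012] M. Green, P. Griffiths, M. Kerr, *Mumford–Tate Groups and Domains*, Annals of Math. Studies 183 (2012):
  §V.D p. 164 («`Res_{K₁/ℚ}𝔾_m ⊃ M_φ̃`»).
* [Deligne1982HodgeCycles] P. Deligne, *Hodge cycles on abelian varieties*, LNM 900 (1982): I §3 proof of Prop. 3.6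
  («`ψ(g₁v, g₁v′) = g₂ⁿψ(v, v′)`»), Example 3.7 («`μ(ℂ^×) ⊂ (E ⊗ ℂ)^×`»).
-/

noncomputable section

open Module
open scoped TensorProduct

namespace Literature.AlgebraicGeometry.Motives

namespace HodgeStructure

namespace EndAction

universe u v w

variable (K : Type w) [Field K] [Algebra ℚ K]
  {V : Type u} [AddCommGroup V] [Module ℚ V] [Module.Finite ℚ V] {n : ℤ} {H : HodgeStructure V n}
  {E : Type v} [Field E] [NumberField E] (A : EndAction H E) (ψ : Polarization H)

/-! ## §1 «An isomorphism of algebras with involution»: `η_K(u)† = η_K(τ_K u)` -/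

section Involution

/-- **`C₀ ⊗ K → C ⊗ K` is compatible with the involutions: `η_K(u)† = η_K(τ_K(u))`** for every `u ∈ F₀ ⊗ K`, where `†` is Milne's
`K`-linear adjoint of `Q_K` (p34 `Polarization.adjointBaseChange K`) and `τ_K = τ ⊗ 1` the scalar extension of the Rosati involution
`τ` of `F₀` (`η(x)† = η(τ x)`, g37-#5) — on pure tensors `(k · η(x)_K)† = k · (η(x)†)_K = k · η(τ x)_K`
(`adjointBaseChange_baseChange`, `K`-linearity of `†`). [cite: Milne1999LefschetzClasses, §1 Prop. 1.7 p. 645 («an isomorphism C₀(A) ⊗ Q → C(A) of Q-algebras with involution»)] -/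
theorem adjointBaseChange_scalarExtensionOver_centralSubfield {τ : A.centralSubfield →ₗ[ℚ] A.centralSubfield}
    (hτ : ∀ x : A.centralSubfield, ψ.adjoint (A.ι (x : E)) = A.ι (τ x : E)) (u : K ⊗[ℚ] A.centralSubfield) :
    ψ.adjointBaseChange K ((A.compHom A.centralSubfield.val).scalarExtensionOver K u) =
      (A.compHom A.centralSubfield.val).scalarExtensionOver K (τ.baseChange K u) := by
  induction u using TensorProduct.induction_on with
  | zero => simp only [map_zero, Polarization.adjointBaseChange_zero]
  | tmul c x =>
    rw [LinearMap.baseChange_tmul, scalarExtensionOver_centralSubfield_tmul, scalarExtensionOver_centralSubfield_tmul,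
      Polarization.adjointBaseChange_smul, Polarization.adjointBaseChange_baseChange, hτ]
  | add u u' hu hu' => simp only [map_add, Polarization.adjointBaseChange_add, hu, hu']

/-- **`τ_K` is multiplicative** on the commutative `K`-algebra `F₀ ⊗ K` (through `η_K`, injective on `F₀ ⊗ K`: `η_K(τ_K(uv)) =
(η_K(u) η_K(v))† = η_K(v)† η_K(u)†`). [cite: Milne1999LefschetzClasses, §1 Prop. 1.7 p. 645] -/
theorem rosati_baseChange_mul (hS : finrank ℚ E = finrank ℚ V) {τ : A.centralSubfield →ₗ[ℚ] A.centralSubfield}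
    (hτ : ∀ x : A.centralSubfield, ψ.adjoint (A.ι (x : E)) = A.ι (τ x : E)) (u v : K ⊗[ℚ] A.centralSubfield) :
    τ.baseChange K (u * v) = τ.baseChange K u * τ.baseChange K v := by
  haveI := nontrivial_of_finrank_eq hS
  apply (A.compHom A.centralSubfield.val).scalarExtensionOver_injective K
  rw [map_mul (f := (A.compHom A.centralSubfield.val).scalarExtensionOver K),
    ← A.adjointBaseChange_scalarExtensionOver_centralSubfield K ψ hτ,
    ← A.adjointBaseChange_scalarExtensionOver_centralSubfield K ψ hτ,
    ← A.adjointBaseChange_scalarExtensionOver_centralSubfield K ψ hτ,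
    map_mul (f := (A.compHom A.centralSubfield.val).scalarExtensionOver K), Polarization.adjointBaseChange_mul,
    A.adjointBaseChange_scalarExtensionOver_centralSubfield K ψ hτ, A.adjointBaseChange_scalarExtensionOver_centralSubfield K ψ hτ,
    ← map_mul (f := (A.compHom A.centralSubfield.val).scalarExtensionOver K),
    ← map_mul (f := (A.compHom A.centralSubfield.val).scalarExtensionOver K), mul_comm]

/-- `τ_K(1) = 1`. [cite: Milne1999LefschetzClasses, §1 Prop. 1.7 p. 645] -/
theorem rosati_baseChange_one (hS : finrank ℚ E = finrank ℚ V) {τ : A.centralSubfield →ₗ[ℚ] A.centralSubfield}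
    (hτ : ∀ x : A.centralSubfield, ψ.adjoint (A.ι (x : E)) = A.ι (τ x : E)) :
    τ.baseChange K (1 : K ⊗[ℚ] A.centralSubfield) = 1 := by
  haveI := nontrivial_of_finrank_eq hS
  apply (A.compHom A.centralSubfield.val).scalarExtensionOver_injective K
  rw [← A.adjointBaseChange_scalarExtensionOver_centralSubfield K ψ hτ, map_one, Polarization.adjointBaseChange_one]

/-- `τ_K` is an involution: `τ_K(τ_K u) = u` (`β†† = β`). [cite: Milne1999LefschetzClasses, §1 Prop. 1.7 p. 645] -/
theorem rosati_baseChange_apply_apply (hS : finrank ℚ E = finrank ℚ V) {τ : A.centralSubfield →ₗ[ℚ] A.centralSubfield}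
    (hτ : ∀ x : A.centralSubfield, ψ.adjoint (A.ι (x : E)) = A.ι (τ x : E)) (u : K ⊗[ℚ] A.centralSubfield) :
    τ.baseChange K (τ.baseChange K u) = u := by
  haveI := nontrivial_of_finrank_eq hS
  apply (A.compHom A.centralSubfield.val).scalarExtensionOver_injective K
  rw [← A.adjointBaseChange_scalarExtensionOver_centralSubfield K ψ hτ,
    ← A.adjointBaseChange_scalarExtensionOver_centralSubfield K ψ hτ, Polarization.adjointBaseChange_adjointBaseChange]

end Involution

omit [Module.Finite ℚ V] in
/-- Milne's commutation condition «`γ ∈ C(A) ⊗ K`» in the product form used by g37-#1. [folklore] -/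
private theorem forall_mul_baseChange_comm_of {γ : (K ⊗[ℚ] V) ≃ₗ[K] (K ⊗[ℚ] V)}
    (h : ∀ a : H.endAlg, ∀ x, (a : Module.End ℚ V).baseChange K (γ x) = γ ((a : Module.End ℚ V).baseChange K x)) :
    ∀ a ∈ H.endAlg, (γ : Module.End K (K ⊗[ℚ] V)) * a.baseChange K = a.baseChange K * γ :=
  fun a ha => LinearMap.ext fun x => (h ⟨a, ha⟩ x).symm

omit [Module.Finite ℚ V] in
/-- The converse conversion. [folklore] -/
private theorem forall_baseChange_apply_of {γ : (K ⊗[ℚ] V) ≃ₗ[K] (K ⊗[ℚ] V)}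
    (h : ∀ a ∈ H.endAlg, (γ : Module.End K (K ⊗[ℚ] V)) * a.baseChange K = a.baseChange K * γ) :
    ∀ a : H.endAlg, ∀ x, (a : Module.End ℚ V).baseChange K (γ x) = γ ((a : Module.End ℚ V).baseChange K x) :=
  fun a x => (LinearMap.congr_fun (h a a.2) x).symm

/-! ## §2 «`S(A) ≅ S₀(A)_{/K}`»: `S(H)(K) = η_K(U_{F₀}(K))` and `Hg(V)(K) ⊂ η_K(U_{F₀}(K))` -/

section Lefschetz

/-- **«`S₀(A)_{/K} ≅ S(A)`» for a strong CM-Hodge structure, on `K`-points**: an automorphism `γ` of `V ⊗ K` lies in the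
Lefschetz group `S(H)(K) = {γ ∈ C(H) ⊗ K | γ†γ = 1}` iff `γ = η_K(u)` for a unit `u` of `F₀ ⊗ K` with `τ_K(u) · u = 1` — i.e.
`S(H)(K) = η_K(U_{F₀}(K))`, `U_{F₀} = {u : u^τ u = 1}` Milne's `S₀` («`S₀(A)(R) = {γ ∈ C₀(A) ⊗ R | γ†γ = 1}`»).
[cite: Milne1999LefschetzClasses, §1 p. 645 (S₀(A)) and Prop. 1.7] [cite: Milne1999, Remark 1.10 (p. 53)] -/
theorem mem_lefschetzGroupBaseChange_iff_exists_units_centralSubfield (hS : finrank ℚ E = finrank ℚ V)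
    {τ : A.centralSubfield →ₗ[ℚ] A.centralSubfield} (hτ : ∀ x : A.centralSubfield, ψ.adjoint (A.ι (x : E)) = A.ι (τ x : E))
    (γ : (K ⊗[ℚ] V) ≃ₗ[K] (K ⊗[ℚ] V)) :
    γ ∈ ψ.lefschetzGroupBaseChange K ↔
      ∃ u : (K ⊗[ℚ] A.centralSubfield)ˣ, (A.compHom A.centralSubfield.val).unitsActionOver K u = γ ∧
        τ.baseChange K (u : K ⊗[ℚ] A.centralSubfield) * u = 1 := by
  haveI := nontrivial_of_finrank_eq hS
  rw [ψ.mem_lefschetzGroupBaseChange_iff_adjointBaseChange_mul_self_eq_one K γ]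
  constructor
  · rintro ⟨hcomm, hunit⟩
    obtain ⟨u, hu⟩ := (A.mem_range_unitsActionOver_centralSubfield_iff K hS γ).2 (forall_mul_baseChange_comm_of K hcomm)
    refine ⟨u, hu, (A.compHom A.centralSubfield.val).scalarExtensionOver_injective K ?_⟩
    rw [map_mul (f := (A.compHom A.centralSubfield.val).scalarExtensionOver K),
      ← A.adjointBaseChange_scalarExtensionOver_centralSubfield K ψ hτ, map_one, ← coe_unitsActionOver, hu]
    exact hunit
  · rintro ⟨u, rfl, hunit⟩
    refine ⟨forall_baseChange_apply_of K ((A.mem_range_unitsActionOver_centralSubfield_iff K hS _).1 ⟨u, rfl⟩), ?_⟩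
    rw [coe_unitsActionOver, A.adjointBaseChange_scalarExtensionOver_centralSubfield K ψ hτ,
      ← map_mul (f := (A.compHom A.centralSubfield.val).scalarExtensionOver K), hunit, map_one]

variable [HodgeTensorFacts.{u, u}]

/-- **«`L(A) ⊃ Hg(A)`» in the `F₀`-coordinates, on `K`-points: `Hg(V)(K) ⊂ η_K(U_{F₀}(K))`** — every `γ ∈ Hg(V)(K)` is `η_K(u)`
for a unit `u` of `F₀ ⊗ K` with `τ_K(u) · u = 1`, for EVERY field `K ⊇ ℚ` (`Hg(V)(K) ⊂ S(H)(K)`, p34, and §2; g37-#5 §4 is the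
case `K = ℚ`). Infinitesimally this is g37-#5's `𝔥 ⊂ η(F₀^{τ=−1})`. [cite: Milne1999LefschetzClasses, §4 p. 660 («L(A) ⊃ Hg(A)») and §1 p. 645]
[cite: GreenGriffithsKerr2012, §V.D p. 164 («Res_{K₁/ℚ}𝔾_m ⊃ M_φ̃»)] -/
theorem exists_units_centralSubfield_of_mem_hodgeGroupBaseChange (hS : finrank ℚ E = finrank ℚ V)
    {τ : A.centralSubfield →ₗ[ℚ] A.centralSubfield} (hτ : ∀ x : A.centralSubfield, ψ.adjoint (A.ι (x : E)) = A.ι (τ x : E))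
    {γ : (K ⊗[ℚ] V) ≃ₗ[K] (K ⊗[ℚ] V)} (hγ : γ ∈ H.hodgeGroupBaseChange K) :
    ∃ u : (K ⊗[ℚ] A.centralSubfield)ˣ, (A.compHom A.centralSubfield.val).unitsActionOver K u = γ ∧
      τ.baseChange K (u : K ⊗[ℚ] A.centralSubfield) * u = 1 :=
  (A.mem_lefschetzGroupBaseChange_iff_exists_units_centralSubfield K ψ hS hτ γ).1
    (ψ.hodgeGroupBaseChange_le_lefschetzGroupBaseChange K hγ)

end Lefschetz

/-! ## §3 «`L(A) ≅ L₀(A)_{/K}`»: `G(H)(K)`, `M_φ̃(K)` and the multiplier -/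

section Similitude

/-- **«`L(A) ≅ L₀(A)_{/K}`, `L₀(A)(R) = {(γ, c) ∈ C₀(A)^× × R^× | γ†γ = c}`» for a strong CM-Hodge structure, on `K`-points**:
`γ ∈ G(H)(K)` (Milne's `{γ ∈ C ⊗ K | γ†γ ∈ K^×}`) iff `γ = η_K(u)` for a unit `u` of `F₀ ⊗ K` and a `c ∈ K^×` with
`τ_K(u) · u = c ⊗ 1`. [cite: Milne1999, Remark 1.10 (p. 53)] [cite: Milne1999LefschetzClasses, §4 p. 659 (G(A))] -/
theorem mem_lefschetzSimilitudeGroupBaseChange_iff_exists_units_centralSubfield (hS : finrank ℚ E = finrank ℚ V)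
    {τ : A.centralSubfield →ₗ[ℚ] A.centralSubfield} (hτ : ∀ x : A.centralSubfield, ψ.adjoint (A.ι (x : E)) = A.ι (τ x : E))
    (γ : (K ⊗[ℚ] V) ≃ₗ[K] (K ⊗[ℚ] V)) :
    γ ∈ ψ.lefschetzSimilitudeGroupBaseChange K ↔
      ∃ u : (K ⊗[ℚ] A.centralSubfield)ˣ, ∃ c : K, c ≠ 0 ∧ (A.compHom A.centralSubfield.val).unitsActionOver K u = γ ∧
        τ.baseChange K (u : K ⊗[ℚ] A.centralSubfield) * u = c • (1 : K ⊗[ℚ] A.centralSubfield) := by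
  haveI := nontrivial_of_finrank_eq hS
  rw [ψ.mem_lefschetzSimilitudeGroupBaseChange_iff_adjointBaseChange_mul_self_eq_smul K γ]
  constructor
  · rintro ⟨hcomm, c, hc, hunit⟩
    obtain ⟨u, hu⟩ := (A.mem_range_unitsActionOver_centralSubfield_iff K hS γ).2 (forall_mul_baseChange_comm_of K hcomm)
    refine ⟨u, c, hc, hu, (A.compHom A.centralSubfield.val).scalarExtensionOver_injective K ?_⟩
    rw [map_mul (f := (A.compHom A.centralSubfield.val).scalarExtensionOver K),
      ← A.adjointBaseChange_scalarExtensionOver_centralSubfield K ψ hτ, map_smul, map_one, ← coe_unitsActionOver, hu]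
    exact hunit
  · rintro ⟨u, c, hc, rfl, hunit⟩
    refine ⟨forall_baseChange_apply_of K ((A.mem_range_unitsActionOver_centralSubfield_iff K hS _).1 ⟨u, rfl⟩), c, hc, ?_⟩
    rw [coe_unitsActionOver, A.adjointBaseChange_scalarExtensionOver_centralSubfield K ψ hτ,
      ← map_mul (f := (A.compHom A.centralSubfield.val).scalarExtensionOver K), hunit, map_smul, map_one]

variable [HodgeTensorFacts.{u, u}]

/-- **`M_φ̃(K) ⊂ η_K(GU_{F₀}(K))` WITH THE MULTIPLIER: every `γ ∈ M_φ̃(K)` is `η_K(u)` for a unit `u` of `F₀ ⊗ K` with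
`τ_K(u) · u = ν(γ) ⊗ 1`**, `ν = Polarization.multiplierChar K` the multiplier character (`γ†γ = ν(γ) · 1`, p34; «the second
coordinate of `γ ↦ (γ, γ†γ) : G(A) ⥲ L(A)`»). [cite: Milne1999, Remark 1.10 (p. 53) («L₀(A)(R) = {(γ, c) … | γ†γ = c}»)]
[cite: Milne1999LefschetzClasses, §4 Thm. 4.4 (p. 659)] [cite: GreenGriffithsKerr2012, §V.D p. 164] -/
theorem exists_units_centralSubfield_of_mem_mumfordTateGroupBaseChange [Nontrivial V] (hS : finrank ℚ E = finrank ℚ V)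
    {τ : A.centralSubfield →ₗ[ℚ] A.centralSubfield} (hτ : ∀ x : A.centralSubfield, ψ.adjoint (A.ι (x : E)) = A.ι (τ x : E))
    (γ : H.mumfordTateGroupBaseChange K) :
    ∃ u : (K ⊗[ℚ] A.centralSubfield)ˣ,
      (A.compHom A.centralSubfield.val).unitsActionOver K u = (γ : (K ⊗[ℚ] V) ≃ₗ[K] (K ⊗[ℚ] V)) ∧
        τ.baseChange K (u : K ⊗[ℚ] A.centralSubfield) * u =
          ((ψ.multiplierChar K γ : Kˣ) : K) • (1 : K ⊗[ℚ] A.centralSubfield) := by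
  obtain ⟨u, hu⟩ := A.mumfordTateGroupBaseChange_le_range_unitsActionOver_centralSubfield K hS γ.2
  refine ⟨u, hu, (A.compHom A.centralSubfield.val).scalarExtensionOver_injective K ?_⟩
  rw [map_mul (f := (A.compHom A.centralSubfield.val).scalarExtensionOver K),
    ← A.adjointBaseChange_scalarExtensionOver_centralSubfield K ψ hτ, map_smul, map_one, ← coe_unitsActionOver, hu]
  exact ψ.adjointBaseChange_mul_self_eq_multiplierChar_smul K γ

/-- The same for g37-#1's homomorphism `M_φ̃(K) → (F₀ ⊗ K)^×`: `τ_K(u(γ)) · u(γ) = ν(γ) ⊗ 1` — the pair `(u(γ), ν(γ))` is a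
`K`-point of Milne's `L₀`. [cite: Milne1999, Remark 1.10 (p. 53)] [cite: GreenGriffithsKerr2012, §V.D p. 164 («Res_{K₁/ℚ}𝔾_m ⊃ M_φ̃»)] -/
theorem rosati_baseChange_mumfordTateCentralUnitsHom_mul_self [Nontrivial V] (hS : finrank ℚ E = finrank ℚ V)
    {τ : A.centralSubfield →ₗ[ℚ] A.centralSubfield} (hτ : ∀ x : A.centralSubfield, ψ.adjoint (A.ι (x : E)) = A.ι (τ x : E))
    (γ : H.mumfordTateGroupBaseChange K) :
    τ.baseChange K (A.mumfordTateCentralUnitsHom K hS γ : K ⊗[ℚ] A.centralSubfield) * A.mumfordTateCentralUnitsHom K hS γ =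
      ((ψ.multiplierChar K γ : Kˣ) : K) • (1 : K ⊗[ℚ] A.centralSubfield) := by
  obtain ⟨u, hu, h⟩ := A.exists_units_centralSubfield_of_mem_mumfordTateGroupBaseChange K ψ hS hτ γ
  have huγ : u = A.mumfordTateCentralUnitsHom K hS γ :=
    (A.compHom A.centralSubfield.val).unitsActionOver_injective K
      (hu.trans (A.unitsActionOver_mumfordTateCentralUnitsHom K hS γ).symm)
  rw [← huγ]
  exact h

end Similitude

/-! ## §4 The Deligne torus: `τ_ℂ(u(z,w)) · u(z,w) = (zw)ⁿ ⊗ 1` -/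

section DeligneTorus

variable [HodgeTensorFacts.{u, u}]

/-- **`τ_ℂ(u(z,w)) · u(z,w) = (zw)ⁿ`** for the unit `u(z,w) ∈ (F₀ ⊗ ℂ)^×` through which the Deligne torus acts
(`η_ℂ(u(z,w)) = h_ℂ(z,w)`, g37-#1 `hodgeTorusCentralUnits`): the multiplier of `h_ℂ(z,w)` on a weight-`n` polarization is `(zw)ⁿ`
(Deligne's «`ψ(g₁v, g₁v′) = g₂ⁿ ψ(v, v′)`», the tree's `coe_multiplierChar_hodgeTorusC`). [cite: Deligne1982HodgeCycles, I §3 proof of Prop. 3.6 and Example 3.7]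
[cite: Milne1999, Remark 1.10 (p. 53)] -/
theorem rosati_baseChange_hodgeTorusCentralUnits_mul_self (hS : finrank ℚ E = finrank ℚ V)
    {τ : A.centralSubfield →ₗ[ℚ] A.centralSubfield} (hτ : ∀ x : A.centralSubfield, ψ.adjoint (A.ι (x : E)) = A.ι (τ x : E))
    (z w : ℂˣ) :
    τ.baseChange ℂ (A.hodgeTorusCentralUnits hS (z, w) : ℂ ⊗[ℚ] A.centralSubfield) * A.hodgeTorusCentralUnits hS (z, w) =
      (((z : ℂ) * w) ^ n) • (1 : ℂ ⊗[ℚ] A.centralSubfield) := by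
  haveI := nontrivial_of_finrank_eq hS
  have h := A.rosati_baseChange_mumfordTateCentralUnitsHom_mul_self ℂ ψ hS hτ
    ⟨H.hodgeTorusC (z, w), hodgeTorusC_mem_mumfordTateGroupBaseChange H (z, w)⟩
  rw [ψ.coe_multiplierChar_hodgeTorusC] at h
  exact h

/-- **The Hodge cocharacter: `τ_ℂ(u(z,1)) · u(z,1) = zⁿ ⊗ 1`** («`μ(ℂ^×) ⊂ (E ⊗ ℂ)^×`» with its norm relation).
[cite: Deligne1982HodgeCycles, I Example 3.7 and §3 proof of Prop. 3.6] -/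
theorem rosati_baseChange_hodgeTorusCentralUnits_one_mul_self (hS : finrank ℚ E = finrank ℚ V)
    {τ : A.centralSubfield →ₗ[ℚ] A.centralSubfield} (hτ : ∀ x : A.centralSubfield, ψ.adjoint (A.ι (x : E)) = A.ι (τ x : E))
    (z : ℂˣ) :
    τ.baseChange ℂ (A.hodgeTorusCentralUnits hS (z, 1) : ℂ ⊗[ℚ] A.centralSubfield) * A.hodgeTorusCentralUnits hS (z, 1) =
      ((z : ℂ) ^ n) • (1 : ℂ ⊗[ℚ] A.centralSubfield) := by
  rw [A.rosati_baseChange_hodgeTorusCentralUnits_mul_self ψ hS hτ z 1, Units.val_one, mul_one]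

end DeligneTorus

end EndAction

end HodgeStructure

end Literature.AlgebraicGeometry.Motives

end
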